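import Literature.NumberTheory.EllipticCurves.HidaFamilyMembersOrdinaryRankProofs
import HarnessLib

/-!
# The elementary half of Hida's rank constancy, and `hida_exists_congruent_ordinary_newform`
# from the Modularity Theorem and the deep half alone (proofs only)

Helper file (theorems only: no definition, no named fact; D-0026) of the seat of the named fact
`Literature.NumberTheory.EllipticCurves.hida_exists_congruent_ordinary_newform`
(`HidaFamilyMembers.lean`), continuing `HidaFamilyMembersOrdinaryRankProofs.lean`.

Hida's **rank constancy** (Hida, *Elementary Modular Iwasawa Theory* (2022), Lemma 4.1.25 =
Cor. 4.2.32; Hida, Invent. Math. 85 (1986), (1.10a)–(1.10b), Thm. 1.1–1.2) says that for `p ∤ N`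
the `W`-rank of the ordinary part of `S_k(Γ₀(N p); W)` — the number of `p`-adic unit eigenvalues
of `U_p` on `S_k(Γ₀(N p))`, counted with multiplicity — does not depend on the weight `k ≥ 2` in a
fixed class modulo `p - 1`.  Write `ord_k(N p)` for this number (trivial character, so the class of
`k ≡ 2 (mod p - 1)`).  The equality `ord_k(N p) = ord_2(N p)` splits into

* the ELEMENTARY inequality `ord_2(N p) ≤ ord_k(N p)` — PROVED here
  (`HidaRank.hida_ordinary_rank_two_le`): multiplication by the Eisenstein series
  `E_{k-2} ≡ 1 (mod p)` is, in Deligne–Serre's integral coordinates, an injective map modulo `𝔪`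
  intertwining the reduced Hecke operators (Deligne–Serre 1974, 6.9–6.11;
  `HidaRank.card_residual_le_of_eisenstein`), so every residual `U_p`-eigenvalue occurs in weight
  `k` at least as often as in weight `2`, and the number of unit `U_p`-eigenvalues is the number of
  diagonal characters of a `U_p`-triangular basis with non-zero residue
  (`HidaRank.finrank_biSup_maxGenEigenspace_eq_card`, `HidaRank.exists_triangular_basis`);
* the DEEP inequality `ord_k(N p) ≤ ord_2(N p)` — Hida's control of the ordinary part (proved in
  the sources cohomologically, EMI §4.2, Cor. 4.2.32, or via `Λ`-adic forms), NOT proved in the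
  tree; it is the ONLY input besides the Modularity Theorem (`exists_isNewformOf`) of
  `hida_exists_congruent_ordinary_newform`
  (`hida_exists_congruent_ordinary_newform_of_exists_isNewformOf_of_rank_le`, which feeds the
  equality recovered from the two inequalities to
  `hida_exists_congruent_ordinary_newform_of_exists_isNewformOf_of_rank_constancy`).

[cite: Hida2022EMI, Lemma 4.1.25, Cor. 4.2.32] [cite: Hida1986, (1.10a)–(1.10b), Thm. 1.1–1.2]
[cite: DeligneSerreASENS1974, 6.9–6.11]
-/

noncomputable section

open scoped MatrixGroups ModularForm
open CongruenceSubgroup UpperHalfPlane Module IsLocalRing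

namespace Literature.NumberTheory.EllipticCurves.ModularForms.HidaRank

/-! ### Counting characters: a fibrewise inequality -/

/-- If every value is taken at most as often by `ψ₂` as by `ψ`, then for every predicate `Q` the
values satisfying `Q` are taken (with multiplicity) at most as often by `ψ₂` as by `ψ`. [folklore] -/
theorem card_filter_comp_le_of_forall_le {X : Type*} [DecidableEq X] {n₂ n : ℕ} (ψ₂ : Fin n₂ → X)
    (ψ : Fin n → X)
    (hle : ∀ χ, (Finset.univ.filter fun i ↦ ψ₂ i = χ).card ≤
      (Finset.univ.filter fun i ↦ ψ i = χ).card)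
    (Q : X → Prop) [DecidablePred Q] :
    (Finset.univ.filter fun i ↦ Q (ψ₂ i)).card ≤ (Finset.univ.filter fun i ↦ Q (ψ i)).card := by
  classical
  -- fibrewise counting over a finite set of values containing all values taken
  set T : Finset X := Finset.univ.image ψ₂ ∪ Finset.univ.image ψ with hT
  have hfib : ∀ {m : ℕ} (φ : Fin m → X) (_ : ∀ i, φ i ∈ T),
      (Finset.univ.filter fun i ↦ Q (φ i)).card =
        ∑ χ ∈ T.filter Q, (Finset.univ.filter fun i ↦ φ i = χ).card := by
    intro m φ hφ
    rw [Finset.card_eq_sum_card_fiberwise (f := φ) (t := T.filter Q) (fun i hi ↦ ?_)]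
    · refine Finset.sum_congr rfl fun χ hχ ↦ ?_
      rw [Finset.filter_filter]
      refine congrArg Finset.card (Finset.filter_congr fun i _ ↦ ?_)
      simp only [and_iff_right_iff_imp]
      intro h
      rw [h]
      exact (Finset.mem_filter.mp hχ).2
    · have hi' : Q (φ i) := by simpa using hi
      exact Finset.mem_coe.mpr (Finset.mem_filter.mpr ⟨hφ i, hi'⟩)
  have hψ₂T : ∀ i, ψ₂ i ∈ T := fun i ↦
    Finset.mem_union_left _ (Finset.mem_image_of_mem _ (Finset.mem_univ _))
  have hψT : ∀ i, ψ i ∈ T := fun i ↦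
    Finset.mem_union_right _ (Finset.mem_image_of_mem _ (Finset.mem_univ _))
  rw [hfib ψ₂ hψ₂T, hfib ψ hψT]
  exact Finset.sum_le_sum fun χ _ ↦ hle χ

/-! ### The elementary half of Hida's rank constancy: `ord_2(N p) ≤ ord_{2+w}(N p)` -/

section EasyHalf

variable {p : ℕ} [Fact p.Prime]

set_option maxHeartbeats 800000 in
/-- **The number of unit `U_p`-eigenvalues grows from weight `2` to weight `2 + w`** (`p ∤ N`,
`w ≥ 3` even, `(p - 1) ∣ w`): the number of `p`-adic unit eigenvalues of `U_p` on `S_2(Γ₀(N p))`,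
counted with multiplicity, is at most the same number on `S_{2+w}(Γ₀(N p))`.  Proof: in the
`U_p`-triangular bases of `exists_triangular_basis` both numbers count the diagonal characters with
non-zero residual `U_p`-eigenvalue (`finrank_biSup_maxGenEigenspace_eq_card`), and every residual
`U_p`-eigenvalue is the reduction of at most as many diagonal characters in weight `2` as in weight
`2 + w`, multiplication by `E_w ≡ 1 (mod p)` being an injective intertwiner modulo `𝔪`
(`card_residual_le_of_eisenstein`).  This is the elementary inequality in Hida's rank constancy.
[cite: Hida2022EMI, Lemma 4.1.25 (the inequality `≤` from weight 2)]
[cite: DeligneSerreASENS1974, 6.9–6.11] -/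
theorem finrank_ordinary_two_le_of_weight (ι : PadicAlgCl p ≃+* ℂ) {N : ℕ} [NeZero N]
    (hpN : ¬ p ∣ N) {w : ℕ} (hw3 : 3 ≤ w) (hwe : Even w) (hpw : (p - 1) ∣ w) :
    (haveI : NeZero p := ⟨(Fact.out : p.Prime).ne_zero⟩;
      finrank ℂ ↥(⨆ (u : ℂ) (_ : ‖ι.symm u‖ = 1),
          (heckeT (Gamma0 (N * p)) 2 p).maxGenEigenspace u) ≤
        finrank ℂ ↥(⨆ (u : ℂ) (_ : ‖ι.symm u‖ = 1),
          (heckeT (Gamma0 (N * p)) (2 + w) p).maxGenEigenspace u)) := by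
  classical
  have hp : p.Prime := Fact.out
  haveI : NeZero p := ⟨hp.ne_zero⟩
  haveI : FiniteDimensional ℂ (CuspForm (Gamma0 (N * p)) 2) :=
    finiteDimensional_cuspForm_gamma0 (N * p) 2
  haveI : FiniteDimensional ℂ (CuspForm (Gamma0 (N * p)) (2 + w)) :=
    finiteDimensional_cuspForm_gamma0 (N * p) (2 + w)
  obtain ⟨O, hO⟩ := exists_valuationSubring_norm ι
  obtain ⟨n₂, b₂, θ₂, lvl₂, _, nf₂, -, -, -, hθ₂, htri₂, -⟩ :=
    exists_triangular_basis ι N hpN 2 le_rfl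
  obtain ⟨n, b, θ, lvl, _, nf, -, -, -, hθ, htri, -⟩ :=
    exists_triangular_basis ι N hpN (2 + w) (by omega)
  -- the one-prime set `S = {p}` and the residual characters of the two bases on it
  have hS : ∀ q, q = p → q.Prime := fun q h ↦ h ▸ hp
  set ψ₂ : Fin n₂ → {q : ℕ // q = p} → ResidueField O :=
    fun i t ↦ residue O ⟨θ₂ i t.1, (hO _).mpr (hθ₂ i t.1 (hS t.1 t.2))⟩ with hψ₂
  set ψ : Fin n → {q : ℕ // q = p} → ResidueField O :=
    fun i t ↦ residue O ⟨θ i t.1, (hO _).mpr (hθ i t.1 (hS t.1 t.2))⟩ with hψ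
  set tp : {q : ℕ // q = p} := ⟨p, rfl⟩ with htp
  calc finrank ℂ ↥(⨆ (u : ℂ) (_ : ‖ι.symm u‖ = 1),
          (heckeT (Gamma0 (N * p)) 2 p).maxGenEigenspace u)
      = (Finset.univ.filter fun i ↦ ‖ι.symm (θ₂ i p)‖ = 1).card :=
        finrank_biSup_maxGenEigenspace_eq_card ι b₂ _ (fun i ↦ θ₂ i p) (htri₂ p hp (Or.inr rfl))
    _ = (Finset.univ.filter fun i ↦ ψ₂ i tp ≠ 0).card :=
        congrArg Finset.card (Finset.filter_congr fun i _ ↦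
          (residue_ne_zero_iff_norm ι hO ⟨θ₂ i p, (hO _).mpr (hθ₂ i p hp)⟩).symm)
    _ ≤ (Finset.univ.filter fun i ↦ ψ i tp ≠ 0).card :=
        card_filter_comp_le_of_forall_le ψ₂ ψ (fun χ ↦
          card_residual_le_of_eisenstein ι hO hw3 hwe hpw (fun q ↦ q = p) hS b₂ θ₂
            (fun i q hq ↦ hθ₂ i q (hS q hq)) (fun q hq i ↦ htri₂ q (hS q hq) (Or.inr hq) i) b θ
            (fun i q hq ↦ hθ i q (hS q hq)) (fun q hq i ↦ htri q (hS q hq) (Or.inr hq) i) χ)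
          (fun χ ↦ χ tp ≠ 0)
    _ = (Finset.univ.filter fun i ↦ ‖ι.symm (θ i p)‖ = 1).card :=
        congrArg Finset.card (Finset.filter_congr fun i _ ↦
          residue_ne_zero_iff_norm ι hO ⟨θ i p, (hO _).mpr (hθ i p hp)⟩)
    _ = finrank ℂ ↥(⨆ (u : ℂ) (_ : ‖ι.symm u‖ = 1),
          (heckeT (Gamma0 (N * p)) (2 + w) p).maxGenEigenspace u) :=
        (finrank_biSup_maxGenEigenspace_eq_card ι b _ (fun i ↦ θ i p) (htri p hp (Or.inr rfl))).symm

/-- **The elementary half of Hida's rank constancy** (the inequality `≤` from weight `2` in Hida,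
*Elementary Modular Iwasawa Theory*, Lemma 4.1.25, special case of trivial nebentypus): for a
prime `p ≥ 5`, a level `N ≥ 1` prime to `p`, a field isomorphism `ι : ℚ̄_p ≃ ℂ` and every weight
`k ≥ 2` with `(p - 1) ∣ (k - 2)`, the number of `p`-adic unit eigenvalues of `U_p` on
`S_2(Γ₀(N p))`, counted with multiplicity, is at most the same number on `S_k(Γ₀(N p))`:
`dim_ℂ ⨁_{|ι⁻¹u|_p = 1} S_2(Γ₀(N p))[U_p ≈ u] ≤ dim_ℂ ⨁_{|ι⁻¹u|_p = 1} S_k(Γ₀(N p))[U_p ≈ u]`.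
PROVED (Deligne–Serre's `E_{k-2}`-trick, `finrank_ordinary_two_le_of_weight`); the reverse
inequality — the deep half of Lemma 4.1.25 (= Cor. 4.2.32) — is not proved in the tree.
[cite: Hida2022EMI, Lemma 4.1.25 (the inequality `≤` from weight 2)]
[cite: DeligneSerreASENS1974, 6.9–6.11] -/
theorem hida_ordinary_rank_two_le (p : ℕ) [Fact p.Prime] (ι : PadicAlgCl p ≃+* ℂ) (N : ℕ)
    [NeZero N] (hp5 : 5 ≤ p) (hpN : ¬ p ∣ N) (k : ℤ) (hk : 2 ≤ k)
    (hpk : ((p : ℤ) - 1) ∣ (k - 2)) :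
    (haveI : NeZero p := ⟨(Fact.out : p.Prime).ne_zero⟩;
      finrank ℂ ↥(⨆ (u : ℂ) (_ : ‖ι.symm u‖ = 1),
          (heckeT (Gamma0 (N * p)) 2 p).maxGenEigenspace u) ≤
        finrank ℂ ↥(⨆ (u : ℂ) (_ : ‖ι.symm u‖ = 1),
          (heckeT (Gamma0 (N * p)) k p).maxGenEigenspace u)) := by
  have hp : p.Prime := Fact.out
  rcases hk.eq_or_lt with rfl | hk2
  · exact le_rfl
  · -- the weight `k = 2 + w`, `w ≥ 3` even and divisible by `p - 1`
    obtain ⟨w, rfl⟩ : ∃ w : ℕ, k = 2 + (w : ℤ) := ⟨(k - 2).toNat, by omega⟩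
    have hpw : (p - 1) ∣ w := by
      have h1 : ((p - 1 : ℕ) : ℤ) ∣ (w : ℤ) := by
        rw [Nat.cast_sub hp.one_le]
        simpa using hpk
      exact_mod_cast h1
    have hw0 : w ≠ 0 := by omega
    have hw3 : 3 ≤ w := by
      have := Nat.le_of_dvd (Nat.pos_of_ne_zero hw0) hpw
      omega
    have hwe : Even w :=
      (even_iff_two_dvd.mp (hp.even_sub_one (by omega))).trans hpw |> even_iff_two_dvd.mpr
    exact finrank_ordinary_two_le_of_weight ι hpN hw3 hwe hpw

end EasyHalf

/-! ### The congruent ordinary newform of level exactly `N` from the deep half alone -/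

section DeepHalf

variable {p : ℕ} [Fact p.Prime]

/-- **From the deep half of rank constancy at the levels `N' p`, `N' ∣ N`, to a congruent
`p`-ordinary newform of weight `2 + w` and level EXACTLY `N`.**  As
`exists_isNewform0_congr_of_rank_constancy`, but assuming only the inequalities
`ord_{2+w}(N' p) ≤ ord_2(N' p)` (`N' ∣ N`): the reverse inequalities are
`finrank_ordinary_two_le_of_weight`. [cite: Hida2022EMI, Lemma 4.1.25] [cite: Hida1986, Cor. 1.3] -/
theorem exists_isNewform0_congr_of_rank_le (ι : PadicAlgCl p ≃+* ℂ) {N : ℕ} [NeZero N]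
    (hpN : ¬ p ∣ N) {w : ℕ} (hw3 : 3 ≤ w) (hwe : Even w) (hpw : (p - 1) ∣ w)
    (hle : ∀ (N' : ℕ) [NeZero N'], N' ∣ N →
      (haveI : NeZero p := ⟨(Fact.out : p.Prime).ne_zero⟩;
        finrank ℂ ↥(⨆ (u : ℂ) (_ : ‖ι.symm u‖ = 1),
            (heckeT (Gamma0 (N' * p)) (2 + w) p).maxGenEigenspace u) ≤
          finrank ℂ ↥(⨆ (u : ℂ) (_ : ‖ι.symm u‖ = 1),
            (heckeT (Gamma0 (N' * p)) 2 p).maxGenEigenspace u)))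
    (c : ℕ → PadicAlgCl p) (hc : ∀ q, q.Prime → ‖c q‖ ≤ 1)
    (f : CuspForm (Gamma0 N) 2) (hf : IsNewform0 f) (hfp : ‖ι.symm ((qExpansion 1 ⇑f).coeff p)‖ = 1)
    (hfc : ∀ q : ℕ, q.Prime → ¬ q ∣ N * p → ‖ι.symm ((qExpansion 1 ⇑f).coeff q) - c q‖ < 1) :
    ∃ g : CuspForm (Gamma0 N) (2 + w), IsNewform0 g ∧ ‖ι.symm ((qExpansion 1 ⇑g).coeff p)‖ = 1 ∧
      ∀ q : ℕ, q.Prime → ¬ q ∣ N * p → ‖ι.symm ((qExpansion 1 ⇑g).coeff q) - c q‖ < 1 :=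
  exists_isNewform0_congr_of_rank_constancy ι hpN hw3 hwe hpw
    (fun N' _ hN' ↦ le_antisymm (hle N' hN')
      (finrank_ordinary_two_le_of_weight ι (fun h ↦ hpN (h.trans hN')) hw3 hwe hpw))
    c hc f hf hfp hfc

end DeepHalf

end Literature.NumberTheory.EllipticCurves.ModularForms.HidaRank

/-! ### Assembly: Modularity + the deep half of rank constancy ⇒ the named fact -/

namespace Literature.NumberTheory.EllipticCurves

open Literature.NumberTheory.EllipticCurves.ModularForms
open Literature.NumberTheory.EllipticCurves.ModularForms.HidaRank

/-- **`hida_exists_congruent_ordinary_newform` from the Modularity Theorem and the DEEP HALF of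
Hida's rank constancy.**  The first hypothesis is the named fact `exists_isNewformOf`
(Breuil–Conrad–Diamond–Taylor 2001, Thm. A).  The second is the inequality
`ord_k(N p) ≤ ord_2(N p)` of Hida, *Elementary Modular Iwasawa Theory*, Lemma 4.1.25
(= Cor. 4.2.32; Hida, Invent. Math. 85 (1986), (1.10a)–(1.10b), Thm. 1.1–1.2), trivial nebentypus:
for `p ≥ 5`, `p ∤ N`, `k ≥ 2` with `(p - 1) ∣ (k - 2)`, the number of `p`-adic unit eigenvalues of
`U_p` on `S_k(Γ₀(N p))`, counted with multiplicity, is AT MOST the same number in weight `2` — the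
half of Hida's lemma that rests on his control of ordinary cohomology; the other half is the
theorem `hida_ordinary_rank_two_le` of this file, and the two give the rank constancy consumed by
`hida_exists_congruent_ordinary_newform_of_exists_isNewformOf_of_rank_constancy`.  No `_holds` is
claimed. [cite: Hida2022EMI, Lemma 4.1.25, Cor. 4.2.32] [cite: Hida1986, Thm. 1.1–1.2, Cor. 1.3]
[cite: BreuilConradDiamondTaylor2001, Thm. A] [cite: DeligneSerreASENS1974, 6.9–6.11] -/
theorem hida_exists_congruent_ordinary_newform_of_exists_isNewformOf_of_rank_le
    (hmod : exists_isNewformOf)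
    (hH : ∀ (p : ℕ) [Fact p.Prime] (ι : PadicAlgCl p ≃+* ℂ) (N : ℕ) [NeZero N], 5 ≤ p →
      ¬ p ∣ N → ∀ k : ℤ, 2 ≤ k → ((p : ℤ) - 1) ∣ (k - 2) →
      (haveI : NeZero p := ⟨(Fact.out : p.Prime).ne_zero⟩;
        finrank ℂ ↥(⨆ (u : ℂ) (_ : ‖ι.symm u‖ = 1),
            (heckeT (Gamma0 (N * p)) k p).maxGenEigenspace u) ≤
          finrank ℂ ↥(⨆ (u : ℂ) (_ : ‖ι.symm u‖ = 1),
            (heckeT (Gamma0 (N * p)) 2 p).maxGenEigenspace u))) :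
    hida_exists_congruent_ordinary_newform :=
  hida_exists_congruent_ordinary_newform_of_exists_isNewformOf_of_rank_constancy hmod
    fun p _ ι N _ hp5 hpN k hk hpk ↦
      le_antisymm (hH p ι N hp5 hpN k hk hpk) (hida_ordinary_rank_two_le p ι N hp5 hpN k hk hpk)

end Literature.NumberTheory.EllipticCurves

end
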